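import Summits.Ventures.CertifiedArithmetic.LowPrec.GemmThetaLawE2M3FamilyWord
import Summits.Ventures.CertifiedArithmetic.LowPrec.GemmTwoBinadeClimb
import HarnessLib

/-!
# GEMM worst case LI-b — the canonical E2M3² (FP6) family for EVERY precision `p ≥ 10`: an
# explicit all-`n` input whose sequential-RNE relative error is `1 - 63θ_p/(63n - 305663K + 2)`

HONEST FRAMING: certified error envelopes and provably optimal rounding/accumulation schemes for
low-precision formats under stated cost models; every table by two implementations; no hardware or
vendor claims.

The UPPER side of the E2M3² θ-law (gemm.tex Thm. `t:thetap6`, FP6 row of the all-precision laws),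
symbolically in the precision.  For a target format `φ` with the grid `2^-6` in range
(`qexp φ ≤ -6`) and `2^(manBits φ + 14) ≤ maxRat φ` (bfloat16, binary32, binary64, …), and
`2^manBits = 512K` (`K = 2^(p-10)`), the family `fam6 K` of file LI-a
(`GemmThetaLawE2M3FamilyWord`; every letter a product of two E2M3 data, `fam6_mem`) has the
explicit piecewise-affine accumulator trajectory `traj6 K` (`fam6_seqSum`): the `K` letters `16`
are summed EXACTLY up to `2·2^manBits` grid units, every `3/64` is `spacing + tie` resolved up,
in binade `j = 1..10` each letter of the pair `(x_j, 2^j)/64` advances the accumulator by exactly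
one grid step (the first exceeds the half-spacing from an even point, the second is a tie from an
odd point resolved up — ties-to-even), the end letter `65/2` rounds up to `v° = (512K+1)·64`, and
every later `-63/2` is absorbed (`fam6_tail`).  Prefix `5377K + 1` letters, mass
`(1058816K + 2080)/64`; hence (`fam6_relErr`) for every `n ≥ 5377K + 1` letters the relative
error is EXACTLY `(63n - 306303K)/(63n - 305663K + 2) = 1 - (640K + 2)/(63n - 305663K + 2)`,
and `640K + 2 = 63·θ_p` with `θ_p = (5·2^manBits + 8)/252 = e2m3Law.thetaL manBits`
(`fam6_defect`).  File LII (`GemmWorstCaseE2M3Prec`) turns this into the upper half of the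
two-sided sandwich for `W⁶_p(n)` and the limit `n(1 - W⁶_p(n)) → θ_p` for every `p ≥ 12`.

Method (no `decide` over trajectories — the precision is a symbol): the binade-step lemma
`rneSigMag_binade_step` (file XLIX-a) and the grid bridge `value_step6` (file LI-a), a
fourteen-way case analysis of the letter index closed by `omega` (`traj6_step`), then the landed
tie-chain assembly `tieChain_spec` / `tieChain_inRange` for the absorbed tail.  This is the
symbolic counterpart of the kernel-evaluated `bfloat16` family `e2m3_1346` (`GemmTerminalE2M3`,
`p = 8`); for `p ≥ 11` the onset `5377K + 1 = 21·2^(p-2) + 2^(p-10) + 1` is the paper's `m_p`.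

References: the E2M3² law and its SUP side for every `p ≥ 12` are `thetaCert_e2m3Law`
(`GemmThetaLawGenE2M3Cert`); explicit worst-case inputs for recursive summation in the literature
are format-by-format ([Higham2002, §4.2], [MullerEtAl2018HFPA, §6.1]; formal FP error analysis
per format in Flocq [BoldoMelquiond2011Flocq]); FP6 (E2M3) values [RouhaniEtAl2023MX, Table 1].
-/

namespace Summit.Ventures.CertifiedArithmetic.LowPrec.Gemm

open Literature.ComputerArithmetic.FloatingPoint
open Literature.ComputerArithmetic.FloatingPoint.MiniFloat
open Literature.ComputerArithmetic.FloatingPoint.MiniFloat.TieChain (seqSum_orbitFn)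
open Finset

variable {φ : Format}

section Steps

variable (hq : φ.qexp ≤ -6) (hR : (2 : ℚ) ^ (φ.manBits + 14) ≤ φ.maxRat)
  {K : ℕ} (hM : 2 ^ φ.manBits = 512 * K)
include hq hR hM

/-- THE PREFIX ROUNDINGS (fourteen cases of the letter index, each one binade step):
`fl_φ(traj6 k + fam6 (k+1)) = traj6 (k+1)` for every `k < 5377K`, and the step is in range.
[cell] -/
theorem traj6_step (k : ℕ) (hk : k < 5377 * K) :
    (roundNE φ (traj6 K k + fam6 K (k + 1))).toRat = traj6 K (k + 1) ∧
      |traj6 K k + fam6 K (k + 1)| ≤ φ.maxRat := by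
  obtain ⟨hK1, hpow, hpow1⟩ := pow_facts6 hM
  have h2 : 2 ∣ 512 * K := ⟨256 * K, by ring⟩
  unfold traj6 fam6
  rcases (by omega : k + 2 < K ∨ k + 2 = K ∨ (K ≤ k + 1 ∧ k + 2 ≤ 257 * K) ∨
      (257 * K ≤ k + 1 ∧ k + 2 ≤ 769 * K) ∨ (769 * K ≤ k + 1 ∧ k + 2 ≤ 1281 * K) ∨
      (1281 * K ≤ k + 1 ∧ k + 2 ≤ 1793 * K) ∨ (1793 * K ≤ k + 1 ∧ k + 2 ≤ 2305 * K) ∨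
      (2305 * K ≤ k + 1 ∧ k + 2 ≤ 2817 * K) ∨ (2817 * K ≤ k + 1 ∧ k + 2 ≤ 3329 * K) ∨
      (3329 * K ≤ k + 1 ∧ k + 2 ≤ 3841 * K) ∨ (3841 * K ≤ k + 1 ∧ k + 2 ≤ 4353 * K) ∨
      (4353 * K ≤ k + 1 ∧ k + 2 ≤ 4865 * K) ∨ (4865 * K ≤ k + 1 ∧ k + 2 ≤ 5377 * K) ∨
      k + 1 = 5377 * K) with
      h | h | h | h | h | h | h | h | h | h | h | h | h | h
  · -- exact prefix: `1024(k+2) < 1024K = 2^(m+1)`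
    refine value_step6 hq hR (n := 1024 * k + 2048) ?_ (by omega) ?_
    · rw [traj6N_P (by omega), fam6Z_P (by omega)]; push_cast; omega
    · rw [traj6N_P (by omega), rneSigMag_of_lt (by rw [hpow1]; omega)]; omega
  · -- the last `16` lands exactly on `2^(m+1) = (512K + 0)·2 + 0` (binade 0, `r = 0`)
    refine value_step6 hq hR (n := (512 * K + 0) * 2 + 0) ?_ (by omega) ?_
    · rw [traj6N_P (by omega), fam6Z_P (by omega)]; push_cast; omega
    · rw [traj6N_P (by omega), rneSigMag_binade_step (j := 0) hM h2 (by norm_num) (by omega)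
        (by norm_num)]
      simp [stepUp]; omega
  · -- binade 0, letter `3 = spacing + 1` from an even point: a tie at an odd `t`, resolved up
    refine value_step6 hq hR (n := (512 * K + (2 * k + 3 - 2 * K)) * 2 + 1) ?_ (by omega) ?_
    · rw [traj6N_B0 (by omega) (by omega), fam6Z_B0 (by omega) (by omega)]; push_cast; omega
    · rw [traj6N_B0 (by omega) (by omega), rneSigMag_binade_step (j := 0) hM h2 (by norm_num)
        (by omega) (by norm_num)]
      simp [stepUp]; omega
  · -- binade 1: `(3, 2)` pairs (grid units), spacing `4`
    obtain ⟨e, he, hek⟩ : ∃ e, e < 512 * K ∧ k + 1 = 257 * K + e :=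
      ⟨k + 1 - 257 * K, by omega, by omega⟩
    rcases Nat.mod_two_eq_zero_or_one e with hp | hp
    · refine value_step6 hq hR (n := (512 * K + e) * 4 + 3) ?_ (by omega) ?_
      · rw [traj6N_T1 (by omega) (by omega), hek, fam6Z_B1 K e he, pairZ_even _ _ hp]
        push_cast; omega
      · rw [traj6N_T1 (by omega) (by omega), rneSigMag_binade_step (j := 1) hM h2 (by norm_num)
          (by omega) (by norm_num)]
        simp [stepUp]; omega
    · refine value_step6 hq hR (n := (512 * K + e) * 4 + 2) ?_ (by omega) ?_
      · rw [traj6N_T1 (by omega) (by omega), hek, fam6Z_B1 K e he, pairZ_odd _ _ hp]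
        push_cast; omega
      · rw [traj6N_T1 (by omega) (by omega), rneSigMag_binade_step (j := 1) hM h2 (by norm_num)
          (by omega) (by norm_num)]
        simp [stepUp]; omega
  · -- binade 2: `(5, 4)` pairs (grid units), spacing `8`
    obtain ⟨e, he, hek⟩ : ∃ e, e < 512 * K ∧ k + 1 = 769 * K + e :=
      ⟨k + 1 - 769 * K, by omega, by omega⟩
    rcases Nat.mod_two_eq_zero_or_one e with hp | hp
    · refine value_step6 hq hR (n := (512 * K + e) * 8 + 5) ?_ (by omega) ?_
      · rw [traj6N_T2 (by omega) (by omega), hek, fam6Z_B2 K e he, pairZ_even _ _ hp]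
        push_cast; omega
      · rw [traj6N_T2 (by omega) (by omega), rneSigMag_binade_step (j := 2) hM h2 (by norm_num)
          (by omega) (by norm_num)]
        simp [stepUp]; omega
    · refine value_step6 hq hR (n := (512 * K + e) * 8 + 4) ?_ (by omega) ?_
      · rw [traj6N_T2 (by omega) (by omega), hek, fam6Z_B2 K e he, pairZ_odd _ _ hp]
        push_cast; omega
      · rw [traj6N_T2 (by omega) (by omega), rneSigMag_binade_step (j := 2) hM h2 (by norm_num)
          (by omega) (by norm_num)]
        simp [stepUp]; omega
  · -- binade 3: `(9, 8)` pairs (grid units), spacing `16`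
    obtain ⟨e, he, hek⟩ : ∃ e, e < 512 * K ∧ k + 1 = 1281 * K + e :=
      ⟨k + 1 - 1281 * K, by omega, by omega⟩
    rcases Nat.mod_two_eq_zero_or_one e with hp | hp
    · refine value_step6 hq hR (n := (512 * K + e) * 16 + 9) ?_ (by omega) ?_
      · rw [traj6N_T3 (by omega) (by omega), hek, fam6Z_B3 K e he, pairZ_even _ _ hp]
        push_cast; omega
      · rw [traj6N_T3 (by omega) (by omega), rneSigMag_binade_step (j := 3) hM h2 (by norm_num)
          (by omega) (by norm_num)]
        simp [stepUp]; omega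
    · refine value_step6 hq hR (n := (512 * K + e) * 16 + 8) ?_ (by omega) ?_
      · rw [traj6N_T3 (by omega) (by omega), hek, fam6Z_B3 K e he, pairZ_odd _ _ hp]
        push_cast; omega
      · rw [traj6N_T3 (by omega) (by omega), rneSigMag_binade_step (j := 3) hM h2 (by norm_num)
          (by omega) (by norm_num)]
        simp [stepUp]; omega
  · -- binade 4: `(18, 16)` pairs (grid units), spacing `32`
    obtain ⟨e, he, hek⟩ : ∃ e, e < 512 * K ∧ k + 1 = 1793 * K + e :=
      ⟨k + 1 - 1793 * K, by omega, by omega⟩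
    rcases Nat.mod_two_eq_zero_or_one e with hp | hp
    · refine value_step6 hq hR (n := (512 * K + e) * 32 + 18) ?_ (by omega) ?_
      · rw [traj6N_T4 (by omega) (by omega), hek, fam6Z_B4 K e he, pairZ_even _ _ hp]
        push_cast; omega
      · rw [traj6N_T4 (by omega) (by omega), rneSigMag_binade_step (j := 4) hM h2 (by norm_num)
          (by omega) (by norm_num)]
        simp [stepUp]; omega
    · refine value_step6 hq hR (n := (512 * K + e) * 32 + 16) ?_ (by omega) ?_
      · rw [traj6N_T4 (by omega) (by omega), hek, fam6Z_B4 K e he, pairZ_odd _ _ hp]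
        push_cast; omega
      · rw [traj6N_T4 (by omega) (by omega), rneSigMag_binade_step (j := 4) hM h2 (by norm_num)
          (by omega) (by norm_num)]
        simp [stepUp]; omega
  · -- binade 5: `(33, 32)` pairs (grid units), spacing `64`
    obtain ⟨e, he, hek⟩ : ∃ e, e < 512 * K ∧ k + 1 = 2305 * K + e :=
      ⟨k + 1 - 2305 * K, by omega, by omega⟩
    rcases Nat.mod_two_eq_zero_or_one e with hp | hp
    · refine value_step6 hq hR (n := (512 * K + e) * 64 + 33) ?_ (by omega) ?_
      · rw [traj6N_T5 (by omega) (by omega), hek, fam6Z_B5 K e he, pairZ_even _ _ hp]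
        push_cast; omega
      · rw [traj6N_T5 (by omega) (by omega), rneSigMag_binade_step (j := 5) hM h2 (by norm_num)
          (by omega) (by norm_num)]
        simp [stepUp]; omega
    · refine value_step6 hq hR (n := (512 * K + e) * 64 + 32) ?_ (by omega) ?_
      · rw [traj6N_T5 (by omega) (by omega), hek, fam6Z_B5 K e he, pairZ_odd _ _ hp]
        push_cast; omega
      · rw [traj6N_T5 (by omega) (by omega), rneSigMag_binade_step (j := 5) hM h2 (by norm_num)
          (by omega) (by norm_num)]
        simp [stepUp]; omega
  · -- binade 6: `(65, 64)` pairs (grid units), spacing `128`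
    obtain ⟨e, he, hek⟩ : ∃ e, e < 512 * K ∧ k + 1 = 2817 * K + e :=
      ⟨k + 1 - 2817 * K, by omega, by omega⟩
    rcases Nat.mod_two_eq_zero_or_one e with hp | hp
    · refine value_step6 hq hR (n := (512 * K + e) * 128 + 65) ?_ (by omega) ?_
      · rw [traj6N_T6 (by omega) (by omega), hek, fam6Z_B6 K e he, pairZ_even _ _ hp]
        push_cast; omega
      · rw [traj6N_T6 (by omega) (by omega), rneSigMag_binade_step (j := 6) hM h2 (by norm_num)
          (by omega) (by norm_num)]
        simp [stepUp]; omega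
    · refine value_step6 hq hR (n := (512 * K + e) * 128 + 64) ?_ (by omega) ?_
      · rw [traj6N_T6 (by omega) (by omega), hek, fam6Z_B6 K e he, pairZ_odd _ _ hp]
        push_cast; omega
      · rw [traj6N_T6 (by omega) (by omega), rneSigMag_binade_step (j := 6) hM h2 (by norm_num)
          (by omega) (by norm_num)]
        simp [stepUp]; omega
  · -- binade 7: `(130, 128)` pairs (grid units), spacing `256`
    obtain ⟨e, he, hek⟩ : ∃ e, e < 512 * K ∧ k + 1 = 3329 * K + e :=
      ⟨k + 1 - 3329 * K, by omega, by omega⟩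
    rcases Nat.mod_two_eq_zero_or_one e with hp | hp
    · refine value_step6 hq hR (n := (512 * K + e) * 256 + 130) ?_ (by omega) ?_
      · rw [traj6N_T7 (by omega) (by omega), hek, fam6Z_B7 K e he, pairZ_even _ _ hp]
        push_cast; omega
      · rw [traj6N_T7 (by omega) (by omega), rneSigMag_binade_step (j := 7) hM h2 (by norm_num)
          (by omega) (by norm_num)]
        simp [stepUp]; omega
    · refine value_step6 hq hR (n := (512 * K + e) * 256 + 128) ?_ (by omega) ?_
      · rw [traj6N_T7 (by omega) (by omega), hek, fam6Z_B7 K e he, pairZ_odd _ _ hp]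
        push_cast; omega
      · rw [traj6N_T7 (by omega) (by omega), rneSigMag_binade_step (j := 7) hM h2 (by norm_num)
          (by omega) (by norm_num)]
        simp [stepUp]; omega
  · -- binade 8: `(260, 256)` pairs (grid units), spacing `512`
    obtain ⟨e, he, hek⟩ : ∃ e, e < 512 * K ∧ k + 1 = 3841 * K + e :=
      ⟨k + 1 - 3841 * K, by omega, by omega⟩
    rcases Nat.mod_two_eq_zero_or_one e with hp | hp
    · refine value_step6 hq hR (n := (512 * K + e) * 512 + 260) ?_ (by omega) ?_
      · rw [traj6N_T8 (by omega) (by omega), hek, fam6Z_B8 K e he, pairZ_even _ _ hp]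
        push_cast; omega
      · rw [traj6N_T8 (by omega) (by omega), rneSigMag_binade_step (j := 8) hM h2 (by norm_num)
          (by omega) (by norm_num)]
        simp [stepUp]; omega
    · refine value_step6 hq hR (n := (512 * K + e) * 512 + 256) ?_ (by omega) ?_
      · rw [traj6N_T8 (by omega) (by omega), hek, fam6Z_B8 K e he, pairZ_odd _ _ hp]
        push_cast; omega
      · rw [traj6N_T8 (by omega) (by omega), rneSigMag_binade_step (j := 8) hM h2 (by norm_num)
          (by omega) (by norm_num)]
        simp [stepUp]; omega
  · -- binade 9: `(520, 512)` pairs (grid units), spacing `1024`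
    obtain ⟨e, he, hek⟩ : ∃ e, e < 512 * K ∧ k + 1 = 4353 * K + e :=
      ⟨k + 1 - 4353 * K, by omega, by omega⟩
    rcases Nat.mod_two_eq_zero_or_one e with hp | hp
    · refine value_step6 hq hR (n := (512 * K + e) * 1024 + 520) ?_ (by omega) ?_
      · rw [traj6N_T9 (by omega) (by omega), hek, fam6Z_B9 K e he, pairZ_even _ _ hp]
        push_cast; omega
      · rw [traj6N_T9 (by omega) (by omega), rneSigMag_binade_step (j := 9) hM h2 (by norm_num)
          (by omega) (by norm_num)]
        simp [stepUp]; omega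
    · refine value_step6 hq hR (n := (512 * K + e) * 1024 + 512) ?_ (by omega) ?_
      · rw [traj6N_T9 (by omega) (by omega), hek, fam6Z_B9 K e he, pairZ_odd _ _ hp]
        push_cast; omega
      · rw [traj6N_T9 (by omega) (by omega), rneSigMag_binade_step (j := 9) hM h2 (by norm_num)
          (by omega) (by norm_num)]
        simp [stepUp]; omega
  · -- binade 10: `(1040, 1024)` pairs (grid units), spacing `2048`
    obtain ⟨e, he, hek⟩ : ∃ e, e < 512 * K ∧ k + 1 = 4865 * K + e :=
      ⟨k + 1 - 4865 * K, by omega, by omega⟩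
    rcases Nat.mod_two_eq_zero_or_one e with hp | hp
    · refine value_step6 hq hR (n := (512 * K + e) * 2048 + 1040) ?_ (by omega) ?_
      · rw [traj6N_T10 (by omega) (by omega), hek, fam6Z_B10 K e he, pairZ_even _ _ hp]
        push_cast; omega
      · rw [traj6N_T10 (by omega) (by omega), rneSigMag_binade_step (j := 10) hM h2 (by norm_num)
          (by omega) (by norm_num)]
        simp [stepUp]; omega
    · refine value_step6 hq hR (n := (512 * K + e) * 2048 + 1024) ?_ (by omega) ?_
      · rw [traj6N_T10 (by omega) (by omega), hek, fam6Z_B10 K e he, pairZ_odd _ _ hp]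
        push_cast; omega
      · rw [traj6N_T10 (by omega) (by omega), rneSigMag_binade_step (j := 10) hM h2 (by norm_num)
          (by omega) (by norm_num)]
        simp [stepUp]; omega
  · -- the end letter `2080 > 2048` from `512K·4096` (binade 11, spacing 4096): up to `v°`
    refine value_step6 hq hR (n := (512 * K + 0) * 4096 + 2080) ?_ (by omega) ?_
    · rw [traj6N_T10 (by omega) (by omega), h, fam6Z_E]; push_cast; omega
    · rw [traj6N_F (by omega), rneSigMag_binade_step (j := 11) hM h2 (by norm_num) (by omega)
        (by norm_num)]
      simp [stepUp]; omega

/-- THE ABSORBED TAIL: at `v° = 32768K + 64` the letter `-63/2` gives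
`v° - 63/2 = 512K·64 + 65/2`, which rounds back up to `v°` (`65/2` exceeds the half-spacing `32`).
[cell, gemm.tex Thm. t:thetap6] -/
theorem tail_fix6 :
    (roundNE φ ((32768 * (K : ℚ) + 64) + (-63 / 2))).toRat = 32768 * (K : ℚ) + 64 ∧
      |(32768 * (K : ℚ) + 64) + (-63 / 2)| ≤ φ.maxRat := by
  obtain ⟨hK1, hpow, -⟩ := pow_facts6 hM
  have h2 : 2 ∣ 512 * K := ⟨256 * K, by ring⟩
  have h := value_step6 hq hR (a := 2097152 * K + 4096) (c := -2016)
    (n := (512 * K + 0) * 4096 + 2080) (b := 2097152 * K + 4096) (by push_cast; omega) (by omega)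
    (by rw [rneSigMag_binade_step (j := 11) hM h2 (by norm_num) (by omega) (by norm_num)]
        simp [stepUp]; omega)
  have e1 : ((2097152 * K + 4096 : ℕ) : ℚ) / 64 + ((-2016 : ℤ) : ℚ) / 64
      = (32768 * (K : ℚ) + 64) + (-63 / 2) := by
    push_cast; ring
  have e2 : ((2097152 * K + 4096 : ℕ) : ℚ) / 64 = 32768 * (K : ℚ) + 64 := by push_cast; ring
  rw [e1, e2] at h
  exact h

/-- `ŝ₀ = 16` (for `K = 1` the first letter is `2^(m+1)` itself). [cell] -/
theorem fam6_s0 : (seqSum φ (fam6 K) 0).toRat = traj6 K 0 := by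
  obtain ⟨hK1, hpow, hpow1⟩ := pow_facts6 hM
  show (roundNE φ (fam6 K 0)).toRat = traj6 K 0
  unfold fam6 traj6
  rw [fam6Z_P (by omega), traj6N_P (by omega)]
  have hr : rneSigMag φ.manBits 1024 = 1024 := by
    rcases Nat.lt_or_ge 1024 (2 ^ (φ.manBits + 1)) with h | h
    · exact rneSigMag_of_lt h
    · have hK : K = 1 := by rw [hpow1] at h; omega
      subst hK
      have h' := rneSigMag_binade_step (t := 0) (r := 0) (j := 0) (u := 2) hM ⟨256, rfl⟩
        (by norm_num) (by norm_num) (by norm_num)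
      simpa [stepUp] using h'
  have h := roundNE_grid6_nat hq hR (n := 1024) (by omega)
  rw [hr] at h
  push_cast at h ⊢
  simpa using h

/-- THE ACCUMULATOR FOLLOWS `traj6` ALONG THE WHOLE PREFIX. [cell] -/
theorem fam6_seqSum : ∀ k ≤ 5377 * K, (seqSum φ (fam6 K) k).toRat = traj6 K k := by
  intro k hk
  have h := seqSum_orbitFn (α := φ) (fam6 K) 0 (5377 * K) (fun j => fam6 K (j + 1)) (traj6 K)
    (fun j _ => by rw [Nat.zero_add]) (fam6_s0 hq hR hM)
    (fun j hj => (traj6_step hq hR hM j hj).1) k hk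
  rwa [Nat.zero_add] at h

/-- The prefix stays in range. [cell] -/
theorem fam6_inRange_prefix : InRange φ (fam6 K) (5377 * K) := by
  obtain ⟨hK1, hpow, -⟩ := pow_facts6 hM
  refine ⟨?_, fun k hk => ?_⟩
  · unfold fam6; rw [fam6Z_P (by omega), abs_of_nonneg (by positivity)]
    exact le_trans (by norm_num) (grid6_le_maxRat hR (n := 1024) (by omega))
  · rw [fam6_seqSum hq hR hM k (le_of_lt hk)]
    exact (traj6_step hq hR hM k hk).2

end Steps

/-! ### The closed form for every length `n ≥ 5377K + 1` -/

section Closed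

variable (hq : φ.qexp ≤ -6) (hR : (2 : ℚ) ^ (φ.manBits + 14) ≤ φ.maxRat)
  {K : ℕ} (hM : 2 ^ φ.manBits = 512 * K)
include hq hR hM

/-- FOR EVERY `k ≥ 5377K`: `ŝₖ = 32768K + 64`, `Σ = (1058816K + 2080)/64 - (63/2)(k - 5377K)`,
`Σ|·| = (1058816K + 2080)/64 + (63/2)(k - 5377K)`. [cell] -/
theorem fam6_tail : ∀ k, 5377 * K ≤ k → (seqSum φ (fam6 K) k).toRat = 32768 * (K : ℚ) + 64 ∧
    ∑ i ∈ range (k + 1), fam6 K i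
      = (1058816 * (K : ℚ) + 2080) / 64 + ((k : ℚ) - (5377 * K : ℕ)) * (-63 / 2) ∧
    ∑ i ∈ range (k + 1), |fam6 K i|
      = (1058816 * (K : ℚ) + 2080) / 64 + ((k : ℚ) - (5377 * K : ℕ)) * (63 / 2) := by
  obtain ⟨hK1, hpow, -⟩ := pow_facts6 hM
  have hx : ∀ k, 5377 * K < k → fam6 K k = -63 / 2 := by
    intro k hk; unfold fam6; rw [fam6Z_tail (by omega)]; norm_num
  have hS : ∑ i ∈ range (5377 * K + 1), fam6 K i = (1058816 * (K : ℚ) + 2080) / 64 := by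
    have h' : ((∑ k ∈ range (5377 * K + 1), fam6Z K k : ℤ) : ℚ)
        = ((1058816 * K + 2080 : ℤ) : ℚ) := by
      rw [sum_fam6Z K]
    push_cast at h'
    unfold fam6
    simp_rw [div_eq_mul_inv]
    rw [← sum_mul, h']
  have hΛ : ∑ i ∈ range (5377 * K + 1), |fam6 K i| = (1058816 * (K : ℚ) + 2080) / 64 := by
    rw [← hS]
    refine sum_congr rfl (fun i hi => abs_of_pos ?_)
    unfold fam6
    have := (fam6Z_mem_pos K i).2 (by have := mem_range.mp hi; omega)
    have : (0 : ℚ) < fam6Z K i := by exact_mod_cast this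
    positivity
  have hv : (seqSum φ (fam6 K) (5377 * K)).toRat = 32768 * (K : ℚ) + 64 := by
    rw [fam6_seqSum hq hR hM _ le_rfl]; unfold traj6; rw [traj6N_F le_rfl]; push_cast; ring
  have h := tieChain_spec (α := φ) (fam6 K) (5377 * K) (-63 / 2) (32768 * (K : ℚ) + 64) _ _ hx hv
    (tail_fix6 hq hR hM).1 hS hΛ
  intro k hk
  obtain ⟨h1, h2, h3⟩ := h k hk
  refine ⟨h1, by simpa using h2, by rw [h3, abs_of_neg (by norm_num)]; push_cast; ring⟩

/-- The family never leaves the finite range of `φ`. [cell] -/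
theorem fam6_inRange : ∀ k, InRange φ (fam6 K) k := by
  refine tieChain_inRange (α := φ) (fam6 K) (5377 * K) (-63 / 2) (32768 * (K : ℚ) + 64)
    (fun k hk => by unfold fam6; rw [fam6Z_tail (by omega)]; norm_num) ?_ (tail_fix6 hq hR hM).1
    (fam6_inRange_prefix hq hR hM) (tail_fix6 hq hR hM).2
  rw [fam6_seqSum hq hR hM _ le_rfl]; unfold traj6; rw [traj6N_F le_rfl]; push_cast; ring

/-- THE CLOSED FORM: for every length `n = k + 1 ≥ 5377K + 1` the relative error of the family is
`(63n - 306303K)/(63n - 305663K + 2)`. [cell, gemm.tex Thm. t:thetap6] -/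
theorem fam6_relErr (k : ℕ) (hk : 5377 * K ≤ k) :
    |(seqSum φ (fam6 K) k).toRat - ∑ i ∈ range (k + 1), fam6 K i| / ∑ i ∈ range (k + 1), |fam6 K i|
      = (63 * ((k : ℚ) + 1) - 306303 * K) / (63 * ((k : ℚ) + 1) - 305663 * K + 2) := by
  obtain ⟨h1, h2, h3⟩ := fam6_tail hq hR hM k hk
  have hk' : ((5377 * K : ℕ) : ℚ) ≤ k := by exact_mod_cast hk
  have hK0 : (0 : ℚ) ≤ K := Nat.cast_nonneg K
  rw [h1, h2, h3]
  push_cast at hk' ⊢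
  have hd1 : (0 : ℚ) < (1058816 * (K : ℚ) + 2080) / 64 + ((k : ℚ) - 5377 * (K : ℚ)) * (63 / 2) := by
    nlinarith
  have hd2 : (0 : ℚ) < 63 * ((k : ℚ) + 1) - 305663 * K + 2 := by nlinarith
  rw [abs_of_nonneg (by nlinarith), div_eq_div_iff hd1.ne' hd2.ne']
  ring

/-- Equivalently `1 - (relative error) = (640K + 2)/(63n - 305663K + 2)` — the numerator is
`63·θ_p`. [cell, gemm.tex Thm. t:thetap6] -/
theorem fam6_defect (k : ℕ) (hk : 5377 * K ≤ k) :
    1 - |(seqSum φ (fam6 K) k).toRat - ∑ i ∈ range (k + 1), fam6 K i|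
        / ∑ i ∈ range (k + 1), |fam6 K i|
      = (640 * (K : ℚ) + 2) / (63 * ((k : ℚ) + 1) - 305663 * K + 2) := by
  rw [fam6_relErr hq hR hM k hk]
  have hk' : ((5377 * K : ℕ) : ℚ) ≤ k := by exact_mod_cast hk
  push_cast at hk'
  have hden : (63 * ((k : ℚ) + 1) - 305663 * K + 2) ≠ 0 := by
    have : (0 : ℚ) ≤ K := Nat.cast_nonneg K
    exact (by nlinarith : (0 : ℚ) < 63 * ((k : ℚ) + 1) - 305663 * K + 2).ne'
  rw [eq_div_iff hden, sub_mul, div_mul_cancel₀ _ hden]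
  ring

end Closed

end Summit.Ventures.CertifiedArithmetic.LowPrec.Gemm
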